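import Mathlib
import Summits.KontsevichZagierPeriods.KontsevichZagierPeriods.Theorems.TorsionLogsNeronTorsionSectorStubGridDataAux
import Summits.KontsevichZagierPeriods.KontsevichZagierPeriods.Theorems.TorsionLogsNeronTorsionSectorStubGridDataAux2
import Summits.KontsevichZagierPeriods.KontsevichZagierPeriods.Theorems.TorsionLogsNeronTorsionSectorStubGridDataAux3
import HarnessLib

/-!
# Stub `stub_gridData` — crux `TorsionLogs.NeronTorsionSector`, line `registered` (block U6), IV:
# interval behaviour of the translations

Auxiliary file for `TorsionLogsNeronTorsionSectorStubGridData.lean`. On the torsion grid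
(`n = 2m`, `nδ = ω`, `x k = X(kδ)`, `y k = Y(kδ)`, `P₁ = (x 1, y 1)`), the lower-branch
translation `τ(t) = (M(t)/(−√f(t) + y 1))²/4 − t − x 1` is `X(u) ↦ X(u + δ)` and the upper-branch
translation `τ⁺(t) = (M(t)/(√f(t) + y 1))²/4 − t − x 1` is `X(u) ↦ X(u − δ)` (`gridData_tau_X`,
`gridData_tau'_X`); since `X` is a strictly decreasing bijection `(0, ω/2] → [e₁, ∞)` with the
mirror symmetry `X(ω − u) = X(u)`, this gives (`gridData_tau_props`, `gridData_tau'_props`):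
`τ` increases on `[x 1, ∞)` onto `[x 2, x 1)`, on `[x (k+1), x k]` onto `[x (k+2), x (k+1)]`
(`k + 2 ≤ m`), and folds `[e₁, x (m−1)]` decreasingly onto itself; `τ⁺` increases on
`[x 2, x 1)` onto `[x 1, ∞)` and on `[x (k+1), x k]` onto `[x k, x (k−1)]` (`2 ≤ k ≤ m − 1`).
Continuity is read off the formulas (`gridData_continuous_transl`).

References: D. F. Lawden, *Elliptic Functions and Applications* (1989), §6.7–6.8, §6.11.
-/

noncomputable section

-- `Summit.KontsevichZagierPeriods.KontsevichZagierPeriods.…` is the tree's mandated layout (single-conjunct summit).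
set_option linter.dupNamespace false

open Set

namespace Summit.KontsevichZagierPeriods.KontsevichZagierPeriods.Cruxes.NeronTorsionSector.Translation

/-! ### Continuity of the regular chord formulas -/

/-- The regular-form translation `t ↦ (M(t)/(ε√f(t) + y₁))²/4 − t − x₁` is continuous on any set
where its denominator does not vanish (`f` a cubic polynomial). [folklore] -/
theorem gridData_continuous_transl : ∀ {g₂ g₃ x₁ y₁ ε : ℝ} {f : ℝ → ℝ} {s : Set ℝ},
    (∀ x, f x = 4 * x ^ 3 - g₂ * x - g₃) → (∀ t ∈ s, ε * Real.sqrt (f t) + y₁ ≠ 0) →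
    ContinuousOn (fun t => ((4 * t ^ 2 + 4 * t * x₁ + 4 * x₁ ^ 2 - g₂) /
      (ε * Real.sqrt (f t) + y₁)) ^ 2 / 4 - t - x₁) s := by
  intro g₂ g₃ x₁ y₁ ε f s hf hs
  have hfc : Continuous f := by
    rw [show f = fun x => 4 * x ^ 3 - g₂ * x - g₃ from funext hf]
    fun_prop
  fun_prop (disch := exact hs)

section Dictionary

variable {g₂ g₃ e₁ ω : ℝ} {f X Y : ℝ → ℝ}
  (hf : ∀ x, f x = 4 * x ^ 3 - g₂ * x - g₃)
  (hD : 0 < ω ∧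
      ω = 2 * ∫ x in Set.Ioi e₁, (Real.sqrt (f x))⁻¹ ∧
      (∀ u, X (u + ω) = X u) ∧ (∀ u, X (-u) = X u) ∧ (∀ u, Y (u + ω) = Y u) ∧ (∀ u, Y (-u) = -Y u) ∧
      X (ω / 2) = e₁ ∧ Y (ω / 2) = 0 ∧
      (∀ u ∈ Set.Ioo 0 ω, u ≠ ω / 2 → e₁ < X u) ∧
      (∀ u ∈ Set.Ioo 0 ω, Y u ^ 2 = f (X u)) ∧
      (∀ u ∈ Set.Ioo 0 (ω / 2), Y u < 0) ∧
      StrictAntiOn X (Set.Ioc 0 (ω / 2)) ∧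
      (∀ x, e₁ < x → ∃ u ∈ Set.Ioo 0 (ω / 2), X u = x) ∧
      (∀ u ∈ Set.Ioc 0 (ω / 2), ∫ x in Set.Ioi (X u), (Real.sqrt (f x))⁻¹ = u) ∧
      (∀ u ∈ Set.Ioo 0 ω, HasDerivAt X (Y u) u ∧ HasDerivAt Y (6 * X u ^ 2 - g₂ / 2) u) ∧
      (∀ u ∈ Set.Ioo 0 ω, ∀ v ∈ Set.Ioo 0 ω, u + v ≠ ω → X u ≠ X v →
        X (u + v) = ((Y u - Y v) / (X u - X v)) ^ 2 / 4 - X u - X v ∧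
        Y (u + v) = -(Y u + (Y u - Y v) / (X u - X v) * (X (u + v) - X u))) ∧
      (∀ u ∈ Set.Ioo 0 ω, u ≠ ω / 2 →
        X (2 * u) = ((6 * X u ^ 2 - g₂ / 2) / Y u) ^ 2 / 4 - 2 * X u ∧
        Y (2 * u) = -(Y u + (6 * X u ^ 2 - g₂ / 2) / Y u * (X (2 * u) - X u))) ∧
      (∀ u ∈ Set.Ioo 0 ω, ∀ v ∈ Set.Ioo 0 ω, X u = X v ↔ (u = v ∨ u + v = ω)))


section Grid

variable {δ : ℝ} {n m : ℕ} {x y : ℕ → ℝ}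
  (hnm : n = 2 * m) (hm : 2 ≤ m) (hnδ : (n : ℝ) * δ = ω)
  (hx : ∀ k, x k = X (k * δ)) (hy : ∀ k, y k = Y (k * δ))

include hD hnm hm hnδ in
/-- Grid parameters: `δ ∈ (0, ω/2)`, `mδ = ω/2`, and `kδ ∈ (0, ω/2]` for `1 ≤ k ≤ m`. [folklore] -/
theorem gridData_delta_facts : δ ∈ Ioo 0 (ω / 2) ∧ (m : ℝ) * δ = ω / 2 ∧
    ∀ k, 1 ≤ k → k ≤ m → (k : ℝ) * δ ∈ Ioc 0 (ω / 2) := by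
  have hω : 0 < ω := hD.1
  have hmem : ∀ k, 1 ≤ k → k ≤ m → (k : ℝ) * δ ∈ Ioc 0 (ω / 2) :=
    fun k hk hkm => gridData_grid_mem hnm hnδ hω hk hkm
  have hmδ : (m : ℝ) * δ = ω / 2 := by
    rw [← hnδ, hnm]
    push_cast
    ring
  have h1 := hmem 1 le_rfl (by omega)
  rw [Nat.cast_one, one_mul] at h1
  refine ⟨⟨h1.1, lt_of_lt_of_le ?_ hmδ.le⟩, hmδ, hmem⟩
  have hm' : (1 : ℝ) < m := by exact_mod_cast (by omega : 1 < m)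
  nlinarith [h1.1]

include hD in
/-- The parametrisation data of `X` on `(0, ω/2]`: `e₁ ≤ X u`, and every `t ≥ e₁` is some `X u`.
[cite: Lawden1989, §6.7] -/
theorem gridData_param : (∀ u ∈ Ioc 0 (ω / 2), e₁ ≤ X u) ∧
    ∀ t, e₁ ≤ t → ∃ u ∈ Ioc 0 (ω / 2), X u = t := by
  obtain ⟨hω, -, -, -, -, -, hXh, -, hXgt, -, -, -, hsurj, -, -, -, -, -⟩ := id hD
  refine ⟨fun u hu => ?_, fun t ht => ?_⟩
  · rcases hu.2.lt_or_eq with h | h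
    · exact (hXgt u ⟨hu.1, by linarith⟩ h.ne).le
    · rw [h, hXh]
  · rcases ht.lt_or_eq with h | h
    · obtain ⟨u, hu, hut⟩ := hsurj t h
      exact ⟨u, ⟨hu.1, hu.2.le⟩, hut⟩
    · exact ⟨ω / 2, ⟨by positivity, le_rfl⟩, by rw [hXh, h]⟩

include hf hD hnm hm hnδ hx hy in
/-- **Interval behaviour of the lower-branch translation `τ = X(· + δ) ∘ X⁻¹`.** The denominator
`−√f + y 1` is negative; `τ` is continuous on `[e₁, ∞)`, strictly increasing on `[x 1, ∞)` with
image `(x 2, x 1)` of the open ray, strictly increasing on each `[x (k+1), x k]` onto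
`[x (k+2), x (k+1)]` (`1 ≤ k`, `k + 2 ≤ m`), and a strictly decreasing fold of `[e₁, x (m−1)]` onto
itself (there `u + δ` passes the half period and `X(u + δ) = X(ω − δ − u)`).
[cite: Lawden1989, §6.8, §6.11] -/
theorem gridData_tau_props : ∀ τ : ℝ → ℝ,
    τ = (fun t => ((4 * t ^ 2 + 4 * t * x 1 + 4 * x 1 ^ 2 - g₂) /
      (-Real.sqrt (f t) + y 1)) ^ 2 / 4 - t - x 1) →
    (∀ t, e₁ < t → -Real.sqrt (f t) + y 1 ≠ 0) ∧ ContinuousOn τ (Set.Ici e₁) ∧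
    StrictMonoOn τ (Set.Ici (x 1)) ∧ τ '' Set.Ioi (x 1) = Set.Ioo (x 2) (x 1) ∧
    (∀ k, 1 ≤ k → k + 2 ≤ m → StrictMonoOn τ (Set.Icc (x (k + 1)) (x k)) ∧
      τ '' Set.Ioo (x (k + 1)) (x k) = Set.Ioo (x (k + 2)) (x (k + 1)) ∧
      τ (x k) = x (k + 1) ∧ τ (x (k + 1)) = x (k + 2)) ∧
    StrictAntiOn τ (Set.Icc e₁ (x (m - 1))) ∧
    τ '' Set.Ioo e₁ (x (m - 1)) = Set.Ioo e₁ (x (m - 1)) ∧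
    τ e₁ = x (m - 1) ∧ τ (x (m - 1)) = e₁ := by
  obtain ⟨hω, -, hXper, hXev, -, -, hXh, hYh, hXgt, hYsq, hYneg, hanti, hsurj, -, -, -, -, -⟩ :=
    id hD
  obtain ⟨hδD, hmδ, hmem⟩ := gridData_delta_facts hD hnm hm hnδ
  obtain ⟨hXe, hsurj'⟩ := gridData_param hD
  have hδ : 0 < δ := hδD.1
  have hδD' : δ ∈ Ioc 0 (ω / 2) := ⟨hδD.1, hδD.2.le⟩
  have e1 : x 1 = X δ := by rw [hx, Nat.cast_one, one_mul]
  have e1' : y 1 = Y δ := by rw [hy, Nat.cast_one, one_mul]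
  have hm1 : ((m - 1 : ℕ) : ℝ) = (m : ℝ) - 1 := by
    rw [Nat.cast_sub (by omega : 1 ≤ m), Nat.cast_one]
  have hmD : (m : ℝ) * δ ∈ Ioc 0 (ω / 2) := hmem m (by omega) le_rfl
  have hm1D : ((m - 1 : ℕ) : ℝ) * δ ∈ Ioc 0 (ω / 2) := hmem (m - 1) (by omega) (by omega)
  have he₁ : e₁ = X ((m : ℝ) * δ) := by rw [hmδ, hXh]
  intro τ hτ
  rw [e1, e1'] at hτ
  have hτX : ∀ u ∈ Ioc 0 (ω / 2), τ (X u) = X (u + δ) := fun u hu =>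
    gridData_tau_X hf hD hδD hτ hu
  have hτX' : ∀ u ∈ Ioc 0 (ω / 2), τ (X u) = X (ω - δ - u) := by
    intro u hu
    rw [hτX u hu, show u + δ = -(ω - δ - u) + ω by ring, hXper, hXev]
  have hden : ∀ t, -Real.sqrt (f t) + Y δ ≠ 0 := fun t => by
    have := Real.sqrt_nonneg (f t)
    have := hYneg δ hδD
    linarith
  refine ⟨fun t _ => by rw [e1']; exact hden t, ?_, ?_, ?_, ?_, ?_, ?_, ?_, ?_⟩
  · -- continuity
    rw [hτ]
    have h := gridData_continuous_transl (ε := -1) (x₁ := X δ) (y₁ := Y δ) (s := Ici e₁) hf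
      (fun t _ => by rw [neg_one_mul]; exact hden t)
    simpa only [neg_one_mul] using h
  · -- increasing on `[x 1, ∞)`
    rw [e1, ← gridData_image_Ioc_zero hanti hXe hsurj' hδD']
    refine gridData_strictMonoOn_conj hanti (fun u hu => ⟨hu.1, hu.2.trans hδD'.2⟩)
      (fun u hu => ⟨by linarith [hu.1], ?_⟩) (fun a _ b _ h => by linarith)
      (fun u hu => hτX u ⟨hu.1, hu.2.trans hδD'.2⟩)
    have := (hmem 2 (by norm_num) hm).2
    push_cast at this
    linarith [hu.2]
  · -- image of `(x 1, ∞)`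
    have h2D : (2 : ℝ) * δ ∈ Ioc 0 (ω / 2) := by
      have := hmem 2 (by norm_num) hm
      push_cast at this
      exact this
    rw [e1, hx 2, Nat.cast_ofNat, ← gridData_image_Ioo_zero hanti hXe hsurj' hδD',
      gridData_image_conj (g := fun u => u + δ) (fun u hu => hτX u ⟨hu.1, hu.2.le.trans hδD'.2⟩),
      image_add_const_Ioo, zero_add, ← two_mul, gridData_image_Ioo hanti hXe hsurj' hδD' h2D]
  · -- the cells `[x (k+1), x k]`, `k + 2 ≤ m`
    intro k hk hkm
    have hkD := hmem k hk (by omega)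
    have hk1D := hmem (k + 1) (by omega) (by omega)
    have hk2D := hmem (k + 2) (by omega) hkm
    have ek1 : ((k + 1 : ℕ) : ℝ) * δ = (k : ℝ) * δ + δ := by push_cast; ring
    have ek2 : ((k + 2 : ℕ) : ℝ) * δ = ((k + 1 : ℕ) : ℝ) * δ + δ := by push_cast; ring
    have hP : Icc ((k : ℝ) * δ) (((k + 1 : ℕ) : ℝ) * δ) ⊆ Ioc 0 (ω / 2) :=
      fun u hu => ⟨hkD.1.trans_le hu.1, hu.2.trans hk1D.2⟩
    have hg : MapsTo (fun u => u + δ) (Icc ((k : ℝ) * δ) (((k + 1 : ℕ) : ℝ) * δ))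
        (Ioc 0 (ω / 2)) := by
      intro u hu
      refine ⟨by linarith [hu.1, hkD.1], ?_⟩
      have := hk2D.2
      rw [ek2] at this
      linarith [hu.2]
    refine ⟨?_, ?_, ?_, ?_⟩
    · rw [hx (k + 1), hx k, ← gridData_image_Icc hanti hXe hsurj' hkD hk1D]
      exact gridData_strictMonoOn_conj hanti hP hg (fun a _ b _ h => by linarith)
        (fun u hu => hτX u (hP hu))
    · rw [hx (k + 1), hx k, hx (k + 2), ← gridData_image_Ioo hanti hXe hsurj' hkD hk1D,
        gridData_image_conj (g := fun u => u + δ)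
          (fun u hu => hτX u (hP (Ioo_subset_Icc_self hu))),
        image_add_const_Ioo, ← ek1, ← ek2, gridData_image_Ioo hanti hXe hsurj' hk1D hk2D]
    · rw [hx k, hτX _ hkD, hx (k + 1), ek1]
    · rw [hx (k + 1), hτX _ hk1D, hx (k + 2), ek2]
  · -- the fold `[e₁, x (m-1)]`, decreasing
    have em : ω - δ - (m : ℝ) * δ = ((m - 1 : ℕ) : ℝ) * δ := by rw [hm1]; linarith [hmδ]
    have hP : Icc (((m - 1 : ℕ) : ℝ) * δ) ((m : ℝ) * δ) ⊆ Ioc 0 (ω / 2) :=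
      fun u hu => ⟨hm1D.1.trans_le hu.1, hu.2.trans hmD.2⟩
    rw [hx (m - 1), he₁, ← gridData_image_Icc hanti hXe hsurj' hm1D hmD]
    refine gridData_strictAntiOn_conj hanti hP (fun u hu => ⟨?_, ?_⟩) (fun a _ b _ h => by linarith)
      (fun u hu => hτX' u (hP hu))
    · have := hu.2; rw [hm1] at *; linarith [hmδ, hm1D.1]
    · have := hu.1; rw [hm1] at *; linarith [hmδ]
  · -- image of the fold
    have em : ω - δ - (m : ℝ) * δ = ((m - 1 : ℕ) : ℝ) * δ := by rw [hm1]; linarith [hmδ]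
    have em' : ω - δ - ((m - 1 : ℕ) : ℝ) * δ = (m : ℝ) * δ := by rw [hm1]; linarith [hmδ]
    have hP : Ioo (((m - 1 : ℕ) : ℝ) * δ) ((m : ℝ) * δ) ⊆ Ioc 0 (ω / 2) :=
      fun u hu => ⟨hm1D.1.trans hu.1, hu.2.le.trans hmD.2⟩
    rw [hx (m - 1), he₁, ← gridData_image_Ioo hanti hXe hsurj' hm1D hmD,
      gridData_image_conj (g := fun u => ω - δ - u) (fun u hu => hτX' u (hP hu)),
      image_const_sub_Ioo, em, em', gridData_image_Ioo hanti hXe hsurj' hm1D hmD]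
  · -- `τ e₁ = x (m-1)`
    rw [he₁, hτX' _ hmD, hx (m - 1), hm1]
    congr 1
    linarith [hmδ]
  · -- `τ (x (m-1)) = e₁`
    rw [hx (m - 1), hτX _ hm1D, he₁, hm1]
    congr 1
    ring

include hf hD hnm hm hnδ hx hy in
/-- **Interval behaviour of the upper-branch translation `τ⁺ = X(· − δ) ∘ X⁻¹`.** On `[e₁, x 1)`
the denominator `√f + y 1` is negative (`f` is increasing on `[e₁, ∞)`, so
`f(t) < f(x 1) = (y 1)²`);
`τ⁺` is continuous there, strictly increasing on `[x 2, x 1)` onto `[x 1, ∞)`, and strictly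
increasing on each `[x (k+1), x k]` onto `[x k, x (k−1)]` (`2 ≤ k`, `k + 1 ≤ m`).
[cite: Lawden1989, §6.8, §6.11] -/
theorem gridData_tau'_props (he : f e₁ = 0) (he0 : 0 < e₁) (hpos : ∀ x, e₁ < x → 0 < f x) :
    ∀ τ' : ℝ → ℝ,
    τ' = (fun t => ((4 * t ^ 2 + 4 * t * x 1 + 4 * x 1 ^ 2 - g₂) /
      (Real.sqrt (f t) + y 1)) ^ 2 / 4 - t - x 1) →
    (∀ t, e₁ ≤ t → t < x 1 → Real.sqrt (f t) + y 1 ≠ 0) ∧ ContinuousOn τ' (Set.Ico e₁ (x 1)) ∧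
    StrictMonoOn τ' (Set.Ico (x 2) (x 1)) ∧ τ' '' Set.Ioo (x 2) (x 1) = Set.Ioi (x 1) ∧
    τ' (x 2) = x 1 ∧
    (∀ k, 2 ≤ k → k + 1 ≤ m → StrictMonoOn τ' (Set.Icc (x (k + 1)) (x k)) ∧
      τ' '' Set.Ioo (x (k + 1)) (x k) = Set.Ioo (x k) (x (k - 1)) ∧
      τ' (x (k + 1)) = x k ∧ τ' (x k) = x (k - 1)) := by
  obtain ⟨hω, -, hXper, hXev, -, -, hXh, hYh, hXgt, hYsq, hYneg, hanti, hsurj, -, -, -, -, -⟩ :=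
    id hD
  obtain ⟨hδD, hmδ, hmem⟩ := gridData_delta_facts hD hnm hm hnδ
  obtain ⟨hXe, hsurj'⟩ := gridData_param hD
  have hδ : 0 < δ := hδD.1
  have hδD' : δ ∈ Ioc 0 (ω / 2) := ⟨hδD.1, hδD.2.le⟩
  have hδω : δ ∈ Ioo 0 ω := ⟨hδD.1, by linarith [hδD.2]⟩
  have e1 : x 1 = X δ := by rw [hx, Nat.cast_one, one_mul]
  have e1' : y 1 = Y δ := by rw [hy, Nat.cast_one, one_mul]
  have h2D : (2 : ℝ) * δ ∈ Ioc 0 (ω / 2) := by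
    have := hmem 2 (by norm_num) hm
    push_cast at this
    exact this
  -- the denominator on `[e₁, x 1)`
  have hy1 : Y δ < 0 := hYneg δ hδD
  have hy1sq : Y δ ^ 2 = f (X δ) := hYsq δ hδω
  have hden : ∀ t, e₁ ≤ t → t < X δ → Real.sqrt (f t) + Y δ < 0 := by
    intro t ht htx
    have hft : f t < f (X δ) := gridData_cubic_lt hf he he0 hpos ht htx
    have hf0 : 0 ≤ f t := by
      rcases ht.lt_or_eq with h | h
      · exact (hpos t h).le
      · rw [← h, he]
    have h1 : Real.sqrt (f t) < Real.sqrt (Y δ ^ 2) := by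
      rw [hy1sq]
      exact Real.sqrt_lt_sqrt hf0 hft
    rw [Real.sqrt_sq_eq_abs, abs_of_neg hy1] at h1
    linarith
  intro τ' hτ'
  rw [e1, e1'] at hτ'
  have hτX : ∀ u ∈ Ioc δ (ω / 2), τ' (X u) = X (u - δ) := by
    intro u hu
    have huD : u ∈ Ioc 0 (ω / 2) := ⟨hδ.trans hu.1, hu.2⟩
    refine gridData_tau'_X hf hD hδD hτ' hu (hden _ (hXe u huD) ?_).ne
    exact hanti hδD' huD hu.1
  refine ⟨fun t ht htx => (hden t ht (by rwa [← e1])).ne |> fun h => by rwa [e1'], ?_, ?_, ?_, ?_,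
    ?_⟩
  · -- continuity on `[e₁, x 1)`
    rw [hτ', e1]
    have h := gridData_continuous_transl (ε := 1) (x₁ := X δ) (y₁ := Y δ) (s := Ico e₁ (X δ)) hf
      (fun t ht => by rw [one_mul]; exact (hden t ht.1 ht.2).ne)
    simpa only [one_mul] using h
  · -- increasing on `[x 2, x 1)`
    rw [e1, hx 2, Nat.cast_ofNat, ← gridData_image_Ioc hanti hXe hsurj' hδD' h2D]
    exact gridData_strictMonoOn_conj hanti (fun u hu => ⟨hδ.trans hu.1, hu.2.trans h2D.2⟩)
      (fun u hu => ⟨by linarith [hu.1], by linarith [hu.2, hδD'.2]⟩) (fun a _ b _ h => by linarith)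
      (fun u hu => hτX u ⟨hu.1, hu.2.trans h2D.2⟩)
  · -- image of `(x 2, x 1)`
    rw [e1, hx 2, Nat.cast_ofNat, ← gridData_image_Ioo hanti hXe hsurj' hδD' h2D,
      gridData_image_conj (g := fun u => u - δ) (fun u hu => hτX u ⟨hu.1, hu.2.le.trans h2D.2⟩),
      image_sub_const_Ioo, sub_self, show (2 : ℝ) * δ - δ = δ by ring,
      gridData_image_Ioo_zero hanti hXe hsurj' hδD']
  · -- `τ' (x 2) = x 1`
    rw [hx 2, Nat.cast_ofNat, hτX _ ⟨by linarith, h2D.2⟩, e1]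
    congr 1
    ring
  · -- the cells `[x (k+1), x k]`, `2 ≤ k ≤ m - 1`
    intro k hk hkm
    have hkD := hmem k (by omega) (by omega)
    have hk1D := hmem (k + 1) (by omega) hkm
    have hk0D := hmem (k - 1) (by omega) (by omega)
    have hkm1 : ((k - 1 : ℕ) : ℝ) = (k : ℝ) - 1 := by
      rw [Nat.cast_sub (by omega : 1 ≤ k), Nat.cast_one]
    have ek1 : ((k + 1 : ℕ) : ℝ) * δ - δ = (k : ℝ) * δ := by push_cast; ring
    have ek0 : (k : ℝ) * δ - δ = ((k - 1 : ℕ) : ℝ) * δ := by rw [hkm1]; ring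
    have hkδ : δ < (k : ℝ) * δ := by
      have : (1 : ℝ) < k := by exact_mod_cast (by omega : 1 < k)
      nlinarith
    have hP : Icc ((k : ℝ) * δ) (((k + 1 : ℕ) : ℝ) * δ) ⊆ Ioc δ (ω / 2) :=
      fun u hu => ⟨hkδ.trans_le hu.1, hu.2.trans hk1D.2⟩
    have hPD : Icc ((k : ℝ) * δ) (((k + 1 : ℕ) : ℝ) * δ) ⊆ Ioc 0 (ω / 2) :=
      fun u hu => ⟨hδ.trans (hP hu).1, (hP hu).2⟩
    have hg : MapsTo (fun u => u - δ) (Icc ((k : ℝ) * δ) (((k + 1 : ℕ) : ℝ) * δ))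
        (Ioc 0 (ω / 2)) := by
      intro u hu
      exact ⟨by linarith [(hP hu).1], by linarith [(hP hu).2]⟩
    refine ⟨?_, ?_, ?_, ?_⟩
    · rw [hx (k + 1), hx k, ← gridData_image_Icc hanti hXe hsurj' hkD hk1D]
      exact gridData_strictMonoOn_conj hanti hPD hg (fun a _ b _ h => by linarith)
        (fun u hu => hτX u (hP hu))
    · rw [hx (k + 1), hx k, hx (k - 1), ← gridData_image_Ioo hanti hXe hsurj' hkD hk1D,
        gridData_image_conj (g := fun u => u - δ)
          (fun u hu => hτX u (hP (Ioo_subset_Icc_self hu))),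
        image_sub_const_Ioo, ek1, ek0, gridData_image_Ioo hanti hXe hsurj' hk0D hkD]
    · rw [hx (k + 1), hτX _ (hP (right_mem_Icc.2 ?_)), hx k, ek1]
      exact mul_le_mul_of_nonneg_right (by exact_mod_cast (by omega : k ≤ k + 1)) hδ.le
    · rw [hx k, hτX _ (hP (left_mem_Icc.2 ?_)), hx (k - 1), ek0]
      exact mul_le_mul_of_nonneg_right (by exact_mod_cast (by omega : k ≤ k + 1)) hδ.le

end Grid

end Dictionary

end Summit.KontsevichZagierPeriods.KontsevichZagierPeriods.Cruxes.NeronTorsionSector.Translation
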